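import Mathlib
import Summits.Ventures.PercRepro2.HCov
import Summits.Ventures.PercRepro2.HCovCubic
import Summits.Ventures.PercRepro2.TriDisagreement
import Summits.Ventures.PercRepro2.TriDisagreementPinned
import Summits.Ventures.PercRepro2.TypedSplit
import Summits.Ventures.PercRepro2.OneTypedEdge
import Summits.Ventures.PercRepro2.TypedSeries
import Summits.Ventures.PercRepro2.StarPattern
import Summits.Ventures.PercRepro2.StarIdentities
import Summits.Ventures.PercRepro2.StarDebt

/-!
# The two-pair bases of a star are typed counts of the graph itself (blind cell PercRepro2,
p1 g12; the graph-row reading of the one-rung objects after NEG-108, part II)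

A PAIR block `{s_i, s_j}` of the star at `y` open in a copy is `y` as a series vertex between
`u_i` and `u_j`; pinning `s_j` OPEN (in every copy) and typing `s_i` realises the pair base as a
typed count of the graph `G` itself on the minor `(insert s_i F₀, z₀[s_j ↦ open])`: in the copies
where `s_i` is closed `y` is pendant at `u_j` and invisible (`patCount_close_*`). So

* `B(p₁, q₁) = N(G; the two other star edges of type 1, the shared one open)`
  (**`Btwo_01_02_eq_typedCount`**, `Btwo_01_12_…`, `Btwo_02_12_…`); the one-pair bases are in
  `StarPairs.lean`.

Consequently every pair-block object of the debt identities (`star_212`, `star_122`: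
`B(01₁,02₁)`, `B(02₂)`, `B(02₁,12₁)`, …) is an instance of the GRAPH row 2′TRI on a minor of `G`
(`G` itself, unmarked vertices allowed); the only one-rung objects that are not are those with
the triple block `T` (`B(T₁)`, `B(T₂)`, `E(T;p) = B(p₁,T₁) − B(T₁)`, `Λ(01;02;12)`). Identities only.
-/

namespace Summit.Ventures.PercRepro2

open CovForm CovForm.OneTyped CovForm.TypedRed

namespace StarPattern

section Pairs

variable {V : Type*} {E : Type*} [Fintype E] [DecidableEq E] {R : Type*} [Field R]
  {ends : E → Sym2 V} {o a₁ a₂ a₃ b : V} {s₁ s₂ s₃ : E} {y u₁ u₂ u₃ : V} {F₀ : Finset E}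
  {z₀ : Config E}

omit [Fintype E] in
/-- `x[s₁ ↦ open][s₃ ↦ a′][s₂ ↦ a]` is the star pattern `(true, a, a')`. -/
lemma update_132_eq_starSet (h12 : s₁ ≠ s₂) (h13 : s₁ ≠ s₃) (h23 : s₂ ≠ s₃) (a a' : Bool)
    (x : Config E) :
    Function.update (Function.update (Function.update x s₁ true) s₃ a') s₂ a =
      starSet s₁ s₂ s₃ (true, a, a') x := by
  funext g
  rw [starSet_apply h12 h13 h23]
  simp only [Function.update_apply]
  split_ifs <;> simp_all

/-- One placement term with `s₁` pinned open and `s₂`, `s₃` placed. -/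
lemma pinned_term_132 (D : StarData ends o a₁ a₂ a₃ b s₁ s₂ s₃ y u₁ u₂ u₃ F₀ z₀)
    (τ : E → ℕ) (hz₁ : z₀ s₁ = false) (hz₂ : z₀ s₂ = false) (hz₃ : z₀ s₃ = false)
    (a b' c a' b'' c' : Bool) :
    typedCount F₀
        (Function.update (Function.update (Function.update z₀ s₁ true) s₂ false) s₃ false)
        (Function.update (Function.update τ s₃ 1) s₂ 1)
        (fun x y w => (K3 ends o a₁ a₂ a₃ b : Config E → Config E → Config E → R)
          (Function.update (Function.update x s₃ a') s₂ a)
          (Function.update (Function.update y s₃ b'') s₂ b')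
          (Function.update (Function.update w s₃ c') s₂ c)) =
      patCount ends o a₁ a₂ a₃ b s₁ s₂ s₃ F₀ z₀ τ (true, a, a') (true, b', b'') (true, c, c') := by
  rw [typedCount_congr_τ F₀ _ (τ' := τ) (fun e he => by
    rw [Function.update_of_ne (ne_of_mem_of_not_mem he D.hF₂),
      Function.update_of_ne (ne_of_mem_of_not_mem he D.hF₃)])]
  rw [typedCount_repin_false F₀ s₁ D.hF₁]
  have hzj : Function.update (Function.update (Function.update z₀ s₁ true) s₂ false) s₃ false
      s₁ = true := by
    rw [Function.update_of_ne D.h13, Function.update_of_ne D.h12, Function.update_self]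
  rw [hzj]
  have hz : Function.update (Function.update (Function.update (Function.update z₀ s₁ true) s₂
      false) s₃ false) s₁ false = z₀ := by
    funext g
    simp only [Function.update_apply]
    split_ifs <;> simp_all
  rw [hz]
  unfold patCount patKernel
  refine typedCount_congr_on F₀ z₀ τ fun x y w _ _ => ?_
  rw [update_132_eq_starSet D.h12 D.h13 D.h23, update_132_eq_starSet D.h12 D.h13 D.h23,
    update_132_eq_starSet D.h12 D.h13 D.h23]

/-- **The two-pair base `B(01₁, 02₁)` is a typed count of the graph**: `s₁` pinned open,
`s₂` and `s₃` of type `1`. -/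
theorem Btwo_01_02_eq_typedCount (D : StarData ends o a₁ a₂ a₃ b s₁ s₂ s₃ y u₁ u₂ u₃ F₀ z₀)
    (τ : E → ℕ) (hz₁ : z₀ s₁ = false) (hz₂ : z₀ s₂ = false) (hz₃ : z₀ s₃ = false) :
    typedCount (insert s₂ (insert s₃ F₀)) (Function.update z₀ s₁ true)
        (Function.update (Function.update τ s₃ 1) s₂ 1) (K3 ends o a₁ a₂ a₃ b : Config E → Config E
          → Config E → R) =
      Btwo ends o a₁ a₂ a₃ b s₁ s₂ s₃ F₀ z₀ τ (true, true, false) (true, false, true) := by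
  have hF : s₂ ∉ insert s₃ F₀ := by
    simp only [Finset.mem_insert, not_or]; exact ⟨D.h23, D.hF₂⟩
  rw [typedCount_split (insert s₂ (insert s₃ F₀)) s₂ (Finset.mem_insert_self _ _)]
  simp only [Function.update_self, Finset.erase_insert hF, sum_bool3_one]
  simp only [typedCount_split (insert s₃ F₀) s₃ (Finset.mem_insert_self _ _),
    Function.update_of_ne D.h23.symm, Function.update_self, Finset.erase_insert D.hF₃,
    sum_bool3_one]
  simp only [pinned_term_132 D τ hz₁ hz₂ hz₃]
  simp only [patCount_close_x D τ (Or.inl rfl), patCount_close_y D τ _ (Or.inl rfl),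
    patCount_close_w D τ _ _ (Or.inl rfl)]
  unfold Btwo
  simp only [orU, Bool.or_self, Bool.or_true, Bool.or_false]
  ring

omit [Fintype E] in
/-- `x[s₂ ↦ open][s₃ ↦ a′][s₁ ↦ a]` is the star pattern `(a, true, a')`. -/
lemma update_231_eq_starSet (h12 : s₁ ≠ s₂) (h13 : s₁ ≠ s₃) (h23 : s₂ ≠ s₃) (a a' : Bool)
    (x : Config E) :
    Function.update (Function.update (Function.update x s₂ true) s₃ a') s₁ a =
      starSet s₁ s₂ s₃ (a, true, a') x := by
  funext g
  rw [starSet_apply h12 h13 h23]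
  simp only [Function.update_apply]
  split_ifs <;> simp_all

/-- One placement term with `s₂` pinned open and `s₁`, `s₃` placed. -/
lemma pinned_term_231 (D : StarData ends o a₁ a₂ a₃ b s₁ s₂ s₃ y u₁ u₂ u₃ F₀ z₀)
    (τ : E → ℕ) (hz₁ : z₀ s₁ = false) (hz₂ : z₀ s₂ = false) (hz₃ : z₀ s₃ = false)
    (a b' c a' b'' c' : Bool) :
    typedCount F₀
        (Function.update (Function.update (Function.update z₀ s₂ true) s₁ false) s₃ false)
        (Function.update (Function.update τ s₃ 1) s₁ 1)
        (fun x y w => (K3 ends o a₁ a₂ a₃ b : Config E → Config E → Config E → R)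
          (Function.update (Function.update x s₃ a') s₁ a)
          (Function.update (Function.update y s₃ b'') s₁ b')
          (Function.update (Function.update w s₃ c') s₁ c)) =
      patCount ends o a₁ a₂ a₃ b s₁ s₂ s₃ F₀ z₀ τ (a, true, a') (b', true, b'') (c, true, c') := by
  rw [typedCount_congr_τ F₀ _ (τ' := τ) (fun e he => by
    rw [Function.update_of_ne (ne_of_mem_of_not_mem he D.hF₁),
      Function.update_of_ne (ne_of_mem_of_not_mem he D.hF₃)])]
  rw [typedCount_repin_false F₀ s₂ D.hF₂]
  have hzj : Function.update (Function.update (Function.update z₀ s₂ true) s₁ false) s₃ false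
      s₂ = true := by
    rw [Function.update_of_ne D.h23, Function.update_of_ne D.h12.symm, Function.update_self]
  rw [hzj]
  have hz : Function.update (Function.update (Function.update (Function.update z₀ s₂ true) s₁
      false) s₃ false) s₂ false = z₀ := by
    funext g
    simp only [Function.update_apply]
    split_ifs <;> simp_all
  rw [hz]
  unfold patCount patKernel
  refine typedCount_congr_on F₀ z₀ τ fun x y w _ _ => ?_
  rw [update_231_eq_starSet D.h12 D.h13 D.h23, update_231_eq_starSet D.h12 D.h13 D.h23,
    update_231_eq_starSet D.h12 D.h13 D.h23]

/-- **The two-pair base `B(01₁, 12₁)` is a typed count of the graph**: `s₂` pinned open,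
`s₁` and `s₃` of type `1`. -/
theorem Btwo_01_12_eq_typedCount (D : StarData ends o a₁ a₂ a₃ b s₁ s₂ s₃ y u₁ u₂ u₃ F₀ z₀)
    (τ : E → ℕ) (hz₁ : z₀ s₁ = false) (hz₂ : z₀ s₂ = false) (hz₃ : z₀ s₃ = false) :
    typedCount (insert s₁ (insert s₃ F₀)) (Function.update z₀ s₂ true)
        (Function.update (Function.update τ s₃ 1) s₁ 1) (K3 ends o a₁ a₂ a₃ b : Config E → Config E
          → Config E → R) =
      Btwo ends o a₁ a₂ a₃ b s₁ s₂ s₃ F₀ z₀ τ (true, true, false) (false, true, true) := by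
  have hF : s₁ ∉ insert s₃ F₀ := by
    simp only [Finset.mem_insert, not_or]; exact ⟨D.h13, D.hF₁⟩
  rw [typedCount_split (insert s₁ (insert s₃ F₀)) s₁ (Finset.mem_insert_self _ _)]
  simp only [Function.update_self, Finset.erase_insert hF, sum_bool3_one]
  simp only [typedCount_split (insert s₃ F₀) s₃ (Finset.mem_insert_self _ _),
    Function.update_of_ne D.h13.symm, Function.update_self, Finset.erase_insert D.hF₃,
    sum_bool3_one]
  simp only [pinned_term_231 D τ hz₁ hz₂ hz₃]
  simp only [patCount_close_x D τ (Or.inr (Or.inl rfl)), patCount_close_y D τ _ (Or.inr (Or.inl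
    rfl)), patCount_close_w D τ _ _ (Or.inr (Or.inl rfl))]
  unfold Btwo
  simp only [orU, Bool.or_self, Bool.or_true, Bool.or_false]
  ring

omit [Fintype E] in
/-- `x[s₃ ↦ open][s₂ ↦ a′][s₁ ↦ a]` is the star pattern `(a, a', true)`. -/
lemma update_321_eq_starSet (h12 : s₁ ≠ s₂) (h13 : s₁ ≠ s₃) (h23 : s₂ ≠ s₃) (a a' : Bool)
    (x : Config E) :
    Function.update (Function.update (Function.update x s₃ true) s₂ a') s₁ a =
      starSet s₁ s₂ s₃ (a, a', true) x := by
  funext g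
  rw [starSet_apply h12 h13 h23]
  simp only [Function.update_apply]

/-- One placement term with `s₃` pinned open and `s₁`, `s₂` placed. -/
lemma pinned_term_321 (D : StarData ends o a₁ a₂ a₃ b s₁ s₂ s₃ y u₁ u₂ u₃ F₀ z₀)
    (τ : E → ℕ) (hz₁ : z₀ s₁ = false) (hz₂ : z₀ s₂ = false) (hz₃ : z₀ s₃ = false)
    (a b' c a' b'' c' : Bool) :
    typedCount F₀
        (Function.update (Function.update (Function.update z₀ s₃ true) s₁ false) s₂ false)
        (Function.update (Function.update τ s₂ 1) s₁ 1)
        (fun x y w => (K3 ends o a₁ a₂ a₃ b : Config E → Config E → Config E → R)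
          (Function.update (Function.update x s₂ a') s₁ a)
          (Function.update (Function.update y s₂ b'') s₁ b')
          (Function.update (Function.update w s₂ c') s₁ c)) =
      patCount ends o a₁ a₂ a₃ b s₁ s₂ s₃ F₀ z₀ τ (a, a', true) (b', b'', true) (c, c', true) := by
  rw [typedCount_congr_τ F₀ _ (τ' := τ) (fun e he => by
    rw [Function.update_of_ne (ne_of_mem_of_not_mem he D.hF₁),
      Function.update_of_ne (ne_of_mem_of_not_mem he D.hF₂)])]
  rw [typedCount_repin_false F₀ s₃ D.hF₃]
  have hzj : Function.update (Function.update (Function.update z₀ s₃ true) s₁ false) s₂ false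
      s₃ = true := by
    rw [Function.update_of_ne D.h23.symm, Function.update_of_ne D.h13.symm, Function.update_self]
  rw [hzj]
  have hz : Function.update (Function.update (Function.update (Function.update z₀ s₃ true) s₁
      false) s₂ false) s₃ false = z₀ := by
    funext g
    simp only [Function.update_apply]
    split_ifs <;> simp_all
  rw [hz]
  unfold patCount patKernel
  refine typedCount_congr_on F₀ z₀ τ fun x y w _ _ => ?_
  rw [update_321_eq_starSet D.h12 D.h13 D.h23, update_321_eq_starSet D.h12 D.h13 D.h23,
    update_321_eq_starSet D.h12 D.h13 D.h23]

/-- **The two-pair base `B(02₁, 12₁)` is a typed count of the graph**: `s₃` pinned open,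
`s₁` and `s₂` of type `1`. -/
theorem Btwo_02_12_eq_typedCount (D : StarData ends o a₁ a₂ a₃ b s₁ s₂ s₃ y u₁ u₂ u₃ F₀ z₀)
    (τ : E → ℕ) (hz₁ : z₀ s₁ = false) (hz₂ : z₀ s₂ = false) (hz₃ : z₀ s₃ = false) :
    typedCount (insert s₁ (insert s₂ F₀)) (Function.update z₀ s₃ true)
        (Function.update (Function.update τ s₂ 1) s₁ 1) (K3 ends o a₁ a₂ a₃ b : Config E → Config E
          → Config E → R) =
      Btwo ends o a₁ a₂ a₃ b s₁ s₂ s₃ F₀ z₀ τ (true, false, true) (false, true, true) := by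
  have hF : s₁ ∉ insert s₂ F₀ := by
    simp only [Finset.mem_insert, not_or]; exact ⟨D.h12, D.hF₁⟩
  rw [typedCount_split (insert s₁ (insert s₂ F₀)) s₁ (Finset.mem_insert_self _ _)]
  simp only [Function.update_self, Finset.erase_insert hF, sum_bool3_one]
  simp only [typedCount_split (insert s₂ F₀) s₂ (Finset.mem_insert_self _ _),
    Function.update_of_ne D.h12.symm, Function.update_self, Finset.erase_insert D.hF₂,
    sum_bool3_one]
  simp only [pinned_term_321 D τ hz₁ hz₂ hz₃]
  simp only [patCount_close_x D τ (Or.inr (Or.inr rfl)), patCount_close_y D τ _ (Or.inr (Or.inr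
    rfl)), patCount_close_w D τ _ _ (Or.inr (Or.inr rfl))]
  unfold Btwo
  simp only [orU, Bool.or_self, Bool.or_true, Bool.or_false]
  ring

end Pairs

end StarPattern

end Summit.Ventures.PercRepro2
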